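import Literature.MathematicalPhysics.QuantumFieldTheory.Balaban1983to89.B9LocalLemma24TwoLevelAtLettersY
import Literature.MathematicalPhysics.QuantumFieldTheory.Balaban1983to89.B6ScalarChartV1
import Literature.MathematicalPhysics.QuantumFieldTheory.Balaban1983to89.B10StarCount

/-!
# `Balaban1983to89.B9LocalLemma24TwoLevelCollarY` — T. Bałaban, *Propagators and renormalization transformations for lattice gauge theories. II*,
# Commun. Math. Phys. **96** (1984) 223–250 [Balaban1984PropagatorsII], (2.89) p. 239 «B^j(Λ) = □̃ ∩ B^{j+1}(Λ_{j+1})» with Lemma 2.4 (2.128) p. 245: THE LOCAL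
# LEMMA-2.4 LETTER (Rᴸ²⁴) ON THE REAL GAUGED CLASS `𝒯ᵣ(D)` OF A TWO-LEVEL SITE SET `D` FROM LEVEL GEOMETRY ALONE — the block sets `S`, `T` of dag-n10-c's
# `B9LocalLemma24TwoLevelAtLettersY.local_lemma24_real_twoLevel` PRODUCED from `D`, their disjointness and `LamBond` index facts DISCHARGED from «levels in
# `{j, j+1}` on `D`» and «no site of level `≥ j+2` two big-block steps around `D`» ((2.2)); the label margins stay displayed

[Balaban1985BackgroundPropagators] = T. Bałaban, *Propagators for lattice gauge theories in a background field*, CMP **99** (1985) 389–434, p. 416 («In [4] we have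
proved that the operator G_□(1) is positive»), p. 408 («□̃»); [4] = [Balaban1984PropagatorsII].  Statement-level skeleton with citation tags; proofs where landed;
nothing here is a claim about the Yang–Mills mass gap.
THE PRINT (verbatim, [4] p. 239, (2.89)).  *«We define B^j(Λ) = □̃ ∩ B^{j+1}(Λ_{j+1}), (2.89) and we take Q′*aQ′, Q*aQ equal to Q′*_{j+1}a_{j+1}Q′_{j+1}, Q*_{j+1}a_{j+1}Q_{j+1}
on B^j(Λ), and to Q′*_ja_jQ′_j, Q*_ja_jQ_j on □̃ ∖ B^j(Λ)»*; p. 224, (2.2): *«(L^jη)⁻¹ dist(Ω_j^c, Ω_{j+1}) > RM»*; (2.4): *«the sets B^j(Λ_j), j = 0, …, k, are disjoint»*.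
WHY THIS FILE (cell context, 2026-08-28).  Row 17's centre number `m_□` at `U = 1` (`Summits/…/BalabanUVNodesN06Row17LocalCentreOfLemma24Letter.coer_trIP_padDeltaALocY_
one_of_lemma24_letter`) needs ONE letter: (Rᴸ²⁴) on `𝒯ᵣ(D)` = {real bond fields with vanishing corner staircase sums on the member blocks inside `D`, zero on the bonds
with both ends off `D`}.  One-level cubes: `B9LocalLemma24AtLettersY`.  Cubes meeting `Ω_{j+1}`: dag-n10-c's C6 letter for DISPLAYED block sets `S ⊆ Λ_j`, `T ⊆ Λ_{j+1}`
with the index facts `hIS` («a scale-j bond from S with no end block in T is a Λ_j-bond»), `hIB`.  Where the interface `Λ_j | Λ_{j+1}` crosses the cube boundary, `hIS`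
FAILS for `T` = the `Λ_{j+1}`-blocks INSIDE the cube (a `Λ_j`-block at the edge may have its scale-`j` neighbour outside the cube and inside `Ω_{j+1}`) — which is why
(2.89)'s `B^j(Λ)` carries the ADJACENT big blocks.  THIS FILE builds that `T` — the `Λ_{j+1}`-blocks inside `D` plus the COLLAR big blocks (`Λ_{j+1}`-sites holding an
end block of a scale-`j` bond issuing from the level-`j` part of `D`) — and proves C6's set-theoretic hypotheses from two LEVEL facts: (`h2`) the fine sites of `D` have
levels in `{j, j+1}`; (`hNbr2`) no fine site of level `≥ j+2` lies under a big block two `(j+1)`-steps around a big block meeting `D`.  On a collar block off `D` the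
field vanishes inside, so its corner staircase sums vanish (§0: the staircase of (1.7) runs inside the block) — `D` is NOT enlarged.
* §0 (any `Params`): `val_bounds_of_mem_iterBlock`, ★ `stairSum_cornerV1_eq_zero_of_vanish`.
* §1 (def-Y letters, any block-saturated `D`): `block_subset_of_witness`, `blockOf_tgt_eq_or` ∕ `adj_blockOf_ends` (`B10StarCount.blockOf_shift`),
  `iterBlockOf_succ_eq_blockOf`, ★ `lamSite_blockOf_of_deep`, ★★★ **`local_lemma24_real_twoLevel_of_lev`** — (Rᴸ²⁴) on `𝒯ᵣ(D)` with C6's constant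
  `κ₂ = (12(d+1)²(1 + 12(d+1)L^{2j}))⁻¹((L^{j+1})^{d+2})⁻¹·min(c_f²∕2, w₀∕(L^{j+1})^{d−1})` from `hD h2 hNbr2 hmargS hmargT`, `0 < w₀ ≤ w`.
IMPORTS `B9LocalLemma24TwoLevelAtLettersY` (dag-n10-c, p661314), `B6ScalarChartV1` (chart dictionary), `B10StarCount` (`blockOf_shift`); nothing restated.  The cube
edition (`D := cubeDomY x c`) and the composition with row 17's reduction are the Summits helper `…/BalabanUVNodesN06Row17LocalCentreTwoLevelOfLev`.
HONEST SCOPE.  Finite bookkeeping + transport of C6; `h2`, `hNbr2` and the label margins are DISPLAYED geometric facts about the cube (the margins fail for cubes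
wrapping around the torus chart — re-centred charts, not here); constants C6's, LEVEL-DEPENDENT; NOT a node discharge; count-neutral; one finite 𝕋⁴ programme —
nothing about the mass gap.  Cell `pub-ymgap` (D-0062), node N06 [B9] × N10 ROAD «C», seat `pub-ymgap-dag-n06-j` gen 25, 2026-08-28.  No `sorry`∕`axiom`∕`instance`∕`def`.
-/

noncomputable section

namespace Literature.MathematicalPhysics.QuantumFieldTheory.Balaban1983to89.B9LocalLemma24TwoLevelCollarY

open Literature.MathematicalPhysics.QuantumFieldTheory.Balaban1983to89
open Literature.MathematicalPhysics.QuantumFieldTheory.Balaban1983to89.LatticeFieldCalculus (stairSum stairSum_self)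
open Literature.MathematicalPhysics.QuantumFieldTheory.Balaban1983to89.B5Eq118OneStroke (iterBlock iterBlockOf mem_iterBlock mem_iterBlock_iff
  iterBlockOf_succ)
open Literature.MathematicalPhysics.QuantumFieldTheory.Balaban1983to89.B6SectALemma24OneLevelV1 (cornerV1 toZ toZ_cornerV1 cornerV1_mem_iterBlock
  stairSum_shift_eq_add pow_le_half_sitesPerDir sitesPerDir_zero_eq_mul)

/-! ## §0 Staircase sums on a block whose inside bonds carry nothing (generic lattice bookkeeping) -/

section Stair

variable {P : Params} {k : ℕ} {V : Type*} [AddCommGroup V] [Module ℝ V]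

/-- coordinates of a site of the block `Bᵏ(ȳ)` relative to its corner: `c_μ ≤ x_μ < c_μ + Lᵏ`, and `c_μ + Lᵏ ≤ N` (labels, no wrapping inside a block).
[cite: Balaban1984PropagatorsI, (1.6) p.18; folklore] -/
theorem val_bounds_of_mem_iterBlock (hk : k ≤ P.m + P.K) (yk : Site P k) {x : Site P 0} (hx : x ∈ iterBlock k yk) (μ : Fin P.d) :
    (cornerV1 k yk μ).val ≤ (x μ).val ∧ (x μ).val < (cornerV1 k yk μ).val + P.L ^ k ∧
      (cornerV1 k yk μ).val + P.L ^ k ≤ P.sitesPerDir 0 := by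
  have h := (mem_iterBlock_iff hk yk x).1 hx μ
  have hcv : (cornerV1 k yk μ).val = (yk μ).val * P.L ^ k := by
    have h' := toZ_cornerV1 hk yk μ; change (((cornerV1 k yk μ).val : ℤ)) = _ at h'; exact_mod_cast h'
  have hLk : 0 < P.L ^ k := pow_pos P.L_pos k
  refine ⟨?_, ?_, ?_⟩
  · rw [hcv, ← h]; exact Nat.div_mul_le_self _ _
  · rw [hcv, ← h]; exact Nat.lt_div_mul_add hLk
  · rw [hcv, sitesPerDir_zero_eq_mul hk]
    have hy : (yk μ).val + 1 ≤ P.sitesPerDir k := ZMod.val_lt (yk μ)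
    calc (yk μ).val * P.L ^ k + P.L ^ k = ((yk μ).val + 1) * P.L ^ k := by ring
      _ ≤ P.sitesPerDir k * P.L ^ k := Nat.mul_le_mul_right _ hy

/-- ★ **STAIRCASE SUMS ON A BLOCK CARRYING NOTHING INSIDE**: if a bond field vanishes on every bond with both end points in `Bᵏ(ȳ)`, its staircase sums from the
corner vanish on `Bᵏ(ȳ)` — the staircase `Γ_{c,x}` of (1.7) runs inside the block (induction on the displacement, one bond at a time by `stairSum_shift_eq_add`).
[cite: Balaban1984PropagatorsI, (1.7) p.18, (1.6) p.18; Balaban1984PropagatorsII, (2.121) p.244] -/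
theorem stairSum_cornerV1_eq_zero_of_vanish (hk : k ≤ P.m + P.K) (A : VecField P 0 V) (yk : Site P k)
    (hA : ∀ b : PBond P 0, b.src ∈ iterBlock k yk → b.tgt ∈ iterBlock k yk → A b = 0) :
    ∀ x ∈ iterBlock k yk, stairSum A (cornerV1 k yk) x = 0 := by
  classical
  -- induction on the total displacement `Σ_μ (x_μ − c_μ)` from the corner `c`
  suffices h : ∀ n : ℕ, ∀ x ∈ iterBlock k yk, ∑ μ, ((x μ).val - (cornerV1 k yk μ).val) = n → stairSum A (cornerV1 k yk) x = 0 from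
    fun x hx => h _ x hx rfl
  intro n
  induction n with
  | zero =>
    intro x hx h0
    have hxc : x = cornerV1 k yk := funext fun μ => ZMod.val_injective _ (by
      have h1 := (Finset.sum_eq_zero_iff.1 h0) μ (Finset.mem_univ _); have h2 := (val_bounds_of_mem_iterBlock hk yk hx μ).1; omega)
    rw [hxc, stairSum_self]
  | succ n ih =>
    intro x hx hsum
    -- `x ≠ c`: the least coordinate in which they differ
    have hne : (Finset.univ.filter fun ν : Fin P.d => x ν ≠ cornerV1 k yk ν).Nonempty := by
      by_contra h
      rw [Finset.not_nonempty_iff_eq_empty, Finset.filter_eq_empty_iff] at h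
      rw [show x = cornerV1 k yk from funext fun ν => not_not.1 (h (Finset.mem_univ ν))] at hsum; simp at hsum
    set μ := (Finset.univ.filter fun ν : Fin P.d => x ν ≠ cornerV1 k yk ν).min' hne with hμdef
    have hμ : x μ ≠ cornerV1 k yk μ := (Finset.mem_filter.1 (Finset.min'_mem _ hne)).2
    have hmin : ∀ ν, ν < μ → x ν = cornerV1 k yk ν := fun ν hν => by
      by_contra h; exact not_lt.2 (Finset.min'_le _ ν (Finset.mem_filter.2 ⟨Finset.mem_univ _, h⟩)) hν
    -- labels in direction `μ`
    obtain ⟨hle, hlt, hN⟩ := val_bounds_of_mem_iterBlock hk yk hx μ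
    have hgt : (cornerV1 k yk μ).val < (x μ).val := lt_of_le_of_ne hle fun h => hμ (ZMod.val_injective _ h).symm
    set t : ℕ := (x μ).val - (cornerV1 k yk μ).val - 1 with htdef
    have hxval : (x μ).val = (cornerV1 k yk μ).val + t + 1 := by omega
    have hxμ : x μ = cornerV1 k yk μ + (t : ZMod (P.sitesPerDir 0)) + 1 := by
      rw [← ZMod.natCast_zmod_val (x μ), ← ZMod.natCast_zmod_val (cornerV1 k yk μ), hxval]; push_cast; ring
    -- the predecessor `x'` of `x` in direction `μ`
    set x' : Site P 0 := Function.update x μ (x μ - 1) with hx'def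
    have hx'μ : x' μ = cornerV1 k yk μ + (t : ZMod (P.sitesPerDir 0)) := by
      rw [hx'def, Function.update_self, hxμ]; ring
    have hx'ν : ∀ ν, ν ≠ μ → x' ν = x ν := fun ν hν => by rw [hx'def, Function.update_of_ne hν]
    have hshift : x'.shift μ = x := funext fun ν => by
      by_cases h : ν = μ
      · subst h; simp only [Site.shift, Function.update_self, hx'μ, hxμ]
      · simp only [Site.shift, Function.update_of_ne h, hx'ν ν h]
    have hx'val : (x' μ).val = (cornerV1 k yk μ).val + t := by
      rw [hx'μ, ZMod.val_add, ZMod.val_natCast, Nat.mod_eq_of_lt (show t < P.sitesPerDir 0 by omega),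
        Nat.mod_eq_of_lt (show (cornerV1 k yk μ).val + t < P.sitesPerDir 0 by omega)]
    -- `x'` lies in the block
    have hx' : x' ∈ iterBlock k yk := by
      refine (mem_iterBlock_iff hk _ _).2 fun ν => ?_
      by_cases h : ν = μ
      · have hcv : (cornerV1 k yk μ).val = (yk μ).val * P.L ^ k := by
          have h' := toZ_cornerV1 hk yk μ; change (((cornerV1 k yk μ).val : ℤ)) = _ at h'; exact_mod_cast h'
        rw [h, hx'val, hcv, show (yk μ).val * P.L ^ k + t = t + P.L ^ k * (yk μ).val by ring,
          Nat.add_mul_div_left _ _ (pow_pos P.L_pos k), Nat.div_eq_of_lt (show t < P.L ^ k by omega), zero_add]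
      · rw [hx'ν ν h]; exact (mem_iterBlock_iff hk yk x).1 hx ν
    -- one bond more on the staircase: `A(Γ_{c,x}) = A(Γ_{c,x'}) + A(⟨x', x⟩)`
    have ht1 : t + 1 ≤ P.sitesPerDir 0 / 2 := le_trans (by omega) (pow_le_half_sitesPerDir hk)
    have ht : (x' μ - cornerV1 k yk μ).valMinAbs = t := by
      rw [hx'μ, add_sub_cancel_left, ZMod.valMinAbs_natCast_of_le_half (le_trans (Nat.le_succ t) ht1)]
    have hpre : ∀ ν, ν < μ → x' ν = cornerV1 k yk ν := fun ν hν => by rw [hx'ν ν (ne_of_lt hν)]; exact hmin ν hν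
    have hstep := stairSum_shift_eq_add A (cornerV1 k yk) x' μ hpre ht ht1
    rw [hshift] at hstep
    -- the displacement of `x'` is `n`
    have hsum' : ∑ ν, ((x' ν).val - (cornerV1 k yk ν).val) = n := by
      have hdecomp : ∀ z : Site P 0, ∑ ν, ((z ν).val - (cornerV1 k yk ν).val)
          = ((z μ).val - (cornerV1 k yk μ).val) + ∑ ν ∈ Finset.univ.erase μ, ((z ν).val - (cornerV1 k yk ν).val) :=
        fun z => (Finset.add_sum_erase _ _ (Finset.mem_univ μ)).symm
      have hrest : ∑ ν ∈ Finset.univ.erase μ, ((x' ν).val - (cornerV1 k yk ν).val)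
          = ∑ ν ∈ Finset.univ.erase μ, ((x ν).val - (cornerV1 k yk ν).val) :=
        Finset.sum_congr rfl fun ν hν => by rw [hx'ν ν (Finset.ne_of_mem_erase hν)]
      have hx_dec := hdecomp x
      rw [hsum] at hx_dec; rw [hdecomp x', hrest, hx'val]; omega
    have hbond : A ⟨x', μ⟩ = 0 := hA ⟨x', μ⟩ hx' (by show x'.shift μ ∈ iterBlock k yk; rw [hshift]; exact hx)
    rw [hstep, ih x' hx' hsum', hbond, add_zero]

end Stair

/-! ## §1 The two block sets of a two-level site set `D` at def-Y's letters: `S` = the `Λ_j`-blocks inside `D`, `T` = the `Λ_{j+1}`-blocks inside `D` together with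
the COLLAR big blocks (the `Λ_{j+1}`-blocks containing an end block of a scale-`j` bond issuing from the level-`j` part of `D`) -/

section DefY

open Node00 B6KLevelCensusIndexV1 B6GlobalChartV1
open Literature.MathematicalPhysics.QuantumFieldTheory.Balaban1983to89.B6ScalarChartV1 (lamSite_domT_iff exists_iterBlockOf_eq)
open Literature.MathematicalPhysics.QuantumFieldTheory.Balaban1983to89.Node00.OpsYNablaBridge (chartY)
open Literature.MathematicalPhysics.QuantumFieldTheory.Balaban1983to89.B10StarCount (blockOf_shift)
open Literature.MathematicalPhysics.QuantumFieldTheory.Balaban1983to89.B9LocalLemma24TwoLevelAtLettersY (local_lemma24_real_twoLevel)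
open scoped Matrix

variable {d ℓ : ℕ} {hd : 1 ≤ d + 1} {hL : Odd (ℓ + 1) ∧ 1 < ℓ + 1} {b₀ b₁ : ℝ} (i : KIdx d ℓ hd hL b₀ b₁)

/-- a member block one of whose fine sites lies in a block-saturated `D` lies inside `D`. [cite: Balaban1984PropagatorsII, (2.3)–(2.4) p.224; Balaban1985BackgroundPropagators, p.408] -/
theorem block_subset_of_witness (D : Finset (SiteY i))
    (hD : ∀ (j' : ℕ) (y : Site (PV d ℓ i.m i.K hd hL) j'), (domT i.hN i.D i.hk).LamSite j' y →
      (∀ x ∈ iterBlock j' y, chartY i x ∈ D) ∨ (∀ x ∈ iterBlock j' y, chartY i x ∉ D))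
    {j' : ℕ} {y : Site (PV d ℓ i.m i.K hd hL) j'} (hy : (domT i.hN i.D i.hk).LamSite j' y) (hw : ∃ x ∈ iterBlock j' y, chartY i x ∈ D) :
    ∀ x ∈ iterBlock j' y, chartY i x ∈ D := by
  obtain ⟨x₀, hx₀, hD₀⟩ := hw
  rcases hD j' y hy with h | h
  · exact h
  · exact absurd hD₀ (h x₀ hx₀)

/-- the end blocks of a scale-`j` bond lie in ONE big block or in two `(j+1)`-ADJACENT big blocks. [cite: Balaban1987RG1, (0.1) p.252; folklore] -/
theorem blockOf_tgt_eq_or {j : ℕ} (hj : j + 1 ≤ i.m + i.K) (bb : PBond (PV d ℓ i.m i.K hd hL) j) :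
    blockOf bb.tgt = blockOf bb.src ∨ blockOf bb.tgt = (blockOf bb.src).shift bb.dir := by
  have h := blockOf_shift (P := PV d ℓ i.m i.K hd hL) hj bb.src bb.dir
  change blockOf bb.tgt = _ at h
  by_cases hc : (bb.src bb.dir).val % (PV d ℓ i.m i.K hd hL).L + 1 = (PV d ℓ i.m i.K hd hL).L
  · rw [if_pos hc] at h; exact Or.inr h
  · rw [if_neg hc] at h; exact Or.inl h

/-- the two end blocks `e`, `z` of a scale-`j` bond (in either order) have EQUAL OR ADJACENT big blocks. [cite: Balaban1987RG1, (0.1) p.252; folklore] -/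
theorem adj_blockOf_ends {j : ℕ} (hj : j + 1 ≤ i.m + i.K) (bb : PBond (PV d ℓ i.m i.K hd hL) j) {e z : Site (PV d ℓ i.m i.K hd hL) j}
    (he : e = bb.src ∨ e = bb.tgt) (hz : z = bb.src ∨ z = bb.tgt) :
    blockOf z = blockOf e ∨ ∃ μ, blockOf z = (blockOf e).shift μ ∨ blockOf e = (blockOf z).shift μ := by
  have h := blockOf_tgt_eq_or i hj bb
  rcases he with rfl | rfl <;> rcases hz with rfl | rfl
  · exact Or.inl rfl
  · rcases h with h | h
    · exact Or.inl h
    · exact Or.inr ⟨bb.dir, Or.inl h⟩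
  · rcases h with h | h
    · exact Or.inl h.symm
    · exact Or.inr ⟨bb.dir, Or.inr h⟩
  · exact Or.inl rfl

/-- a fine site `y` under a scale-`j′` site: its `(j′+1)`-fold block point is the big block of that site. [cite: Balaban1984PropagatorsI, (1.18) p.20] -/
theorem iterBlockOf_succ_eq_blockOf {j' : ℕ} {y : Site (PV d ℓ i.m i.K hd hL) 0} {z : Site (PV d ℓ i.m i.K hd hL) j'} (h : iterBlockOf j' y = z) :
    iterBlockOf (j' + 1) y = blockOf z := by
  rw [iterBlockOf_succ, h]

/-- **NO DEEPER SITE TWO BIG-BLOCK STEPS AROUND `D` ⟹ the scale-`j` neighbours of the level-`j` part of `D` are not inside `Ω_{j+1}` unless their big block is a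
`Λ_{j+1}`-site** (the level reading of `¬ Deep`): for a scale-`j` bond with an end block `e ∈ Λ_j` inside `D`, if the other end block `z` is inside `Ω_{j+1}` then its big
block is a `Λ_{j+1}`-site. [cite: Balaban1984PropagatorsII, (2.2)–(2.4) p.224, (2.89) p.239] -/
theorem lamSite_blockOf_of_deep {j : ℕ} (hjk : j + 1 ≤ i.k) (D : Finset (SiteY i))
    (hNbr2 : ∀ Y₀ Y₁ Y₂ : Site (PV d ℓ i.m i.K hd hL) (j + 1),
      (∃ x : Site (PV d ℓ i.m i.K hd hL) 0, iterBlockOf (j + 1) x = Y₀ ∧ chartY i x ∈ D) →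
      (Y₁ = Y₀ ∨ ∃ μ, Y₁ = Y₀.shift μ ∨ Y₀ = Y₁.shift μ) → (Y₂ = Y₁ ∨ ∃ μ, Y₂ = Y₁.shift μ ∨ Y₁ = Y₂.shift μ) →
      ∀ y : Site (PV d ℓ i.m i.K hd hL) 0, iterBlockOf (j + 1) y = Y₂ → i.D.lev (toBox i.hN y : Fin (d + 1) → ℤ) ≤ j + 1)
    (bb : PBond (PV d ℓ i.m i.K hd hL) j) {e z : Site (PV d ℓ i.m i.K hd hL) j} (he : e = bb.src ∨ e = bb.tgt) (hz : z = bb.src ∨ z = bb.tgt)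
    (heS : (domT i.hN i.D i.hk).LamSite j e ∧ ∃ x ∈ iterBlock j e, chartY i x ∈ D) (hdeep : (domT i.hN i.D i.hk).Deep j z) :
    (domT i.hN i.D i.hk).LamSite (j + 1) (blockOf z) ∧ ∀ y : Site (PV d ℓ i.m i.K hd hL) 0, iterBlockOf j y = z →
      i.D.lev (toBox i.hN y : Fin (d + 1) → ℤ) = j + 1 := by
  have hjm : j + 1 ≤ i.m + i.K := hjk.trans i.hk
  -- a fine site under `z` has level `≥ j+1` (deep) and `≤ j+1` (two big-block steps from `D`)
  have hlev : ∀ y : Site (PV d ℓ i.m i.K hd hL) 0, iterBlockOf j y = z → i.D.lev (toBox i.hN y : Fin (d + 1) → ℤ) = j + 1 := by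
    intro y hy
    have hge : j + 1 ≤ i.D.lev (toBox i.hN y : Fin (d + 1) → ℤ) := by
      refine (iterBlockOf_mem_domT_iff i.hN i.D i.hk (by omega) hjk y).1 ?_
      rw [iterBlockOf_succ_eq_blockOf i hy]; exact hdeep
    obtain ⟨x₀, hx₀, hD₀⟩ := heS.2
    have hx₀e : iterBlockOf j x₀ = e := (mem_iterBlock j e x₀).1 hx₀
    have hle := hNbr2 (blockOf e) (blockOf e) (blockOf z) ⟨x₀, iterBlockOf_succ_eq_blockOf i hx₀e, hD₀⟩ (Or.inl rfl)
      (adj_blockOf_ends i hjm bb he hz) y (iterBlockOf_succ_eq_blockOf i hy)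
    omega
  refine ⟨?_, hlev⟩
  obtain ⟨y, hy⟩ := exists_iterBlockOf_eq (hd := hd) (hL := hL) (by omega : j ≤ i.m + i.K) z
  rw [← iterBlockOf_succ_eq_blockOf i hy]
  exact (lamSite_domT_iff i.hN i.D i.hk (j + 1) y).2 (hlev y hy)

/-- ★★★ **THE LOCAL LEMMA-2.4 LETTER (Rᴸ²⁴) ON THE REAL GAUGED CLASS `𝒯ᵣ(D)` OF A TWO-LEVEL SITE SET FROM LEVEL GEOMETRY ALONE.**  At def-Y's letters, `j + 1 ≤ k`,
for a block-saturated site set `D` (`hD`) whose fine sites have levels in `{j, j+1}` (`h2`), such that NO site of level `≥ j+2` lies two big-block steps around a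
big block meeting `D` (`hNbr2` — the collar of (2.2)), with the label margins of one big block off the box boundary for the `Λ_j`-blocks inside `D` (`hmargS`) and
for the `Λ_{j+1}`-blocks one big-block step around a big block meeting `D` (`hmargT`), and weights `≥ w₀ > 0`: every real bond field `v` with vanishing corner
staircase sums on the member blocks inside `D` and vanishing on the bonds with both end points off `D` satisfies
**`κ₂·Σ_b v(b)² ≤ Σ_p ((curlK·v)(p))² + Σ_ι w(ι)·((qK·v)(ι))²`**, `κ₂ = (12(d+1)²(1 + 12(d+1)L^{2j}))⁻¹((L^{j+1})^{d+2})⁻¹·min(c_f²∕2, w₀∕(L^{j+1})^{d−1})` —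
dag-n10-c's `local_lemma24_real_twoLevel` at `S` = the `Λ_j`-blocks inside `D` and `T` = the `Λ_{j+1}`-blocks inside `D` TOGETHER WITH the collar big blocks
(`Λ_{j+1}`-blocks holding an end block of a scale-`j` bond issuing from the level-`j` part of `D`; on those `v` vanishes inside, so the staircase sums vanish by
`stairSum_cornerV1_eq_zero_of_vanish` — [4] (2.89): `B^j(Λ) = □̃ ∩ B^{j+1}(Λ_{j+1})` includes the big blocks ADJACENT to the level-`j` part).
[cite: Balaban1984PropagatorsII, Lemma 2.4 (2.128) p.245, (2.89) p.239, (2.121) p.244, (2.2)–(2.4) p.224; Balaban1985BackgroundPropagators, p.408 (□̃), p.416] -/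
theorem local_lemma24_real_twoLevel_of_lev (hd2 : 2 ≤ d + 1) {j : ℕ} (hjk : j + 1 ≤ i.k) (D : Finset (SiteY i))
    (hD : ∀ (j' : ℕ) (y : Site (PV d ℓ i.m i.K hd hL) j'), (domT i.hN i.D i.hk).LamSite j' y →
      (∀ x ∈ iterBlock j' y, chartY i x ∈ D) ∨ (∀ x ∈ iterBlock j' y, chartY i x ∉ D))
    (h2 : ∀ x : Site (PV d ℓ i.m i.K hd hL) 0, chartY i x ∈ D →
      i.D.lev (toBox i.hN x : Fin (d + 1) → ℤ) = j ∨ i.D.lev (toBox i.hN x : Fin (d + 1) → ℤ) = j + 1)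
    (hNbr2 : ∀ Y₀ Y₁ Y₂ : Site (PV d ℓ i.m i.K hd hL) (j + 1),
      (∃ x : Site (PV d ℓ i.m i.K hd hL) 0, iterBlockOf (j + 1) x = Y₀ ∧ chartY i x ∈ D) →
      (Y₁ = Y₀ ∨ ∃ μ, Y₁ = Y₀.shift μ ∨ Y₀ = Y₁.shift μ) → (Y₂ = Y₁ ∨ ∃ μ, Y₂ = Y₁.shift μ ∨ Y₁ = Y₂.shift μ) →
      ∀ y : Site (PV d ℓ i.m i.K hd hL) 0, iterBlockOf (j + 1) y = Y₂ → i.D.lev (toBox i.hN y : Fin (d + 1) → ℤ) ≤ j + 1)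
    (hmargS : ∀ y : Site (PV d ℓ i.m i.K hd hL) j, (domT i.hN i.D i.hk).LamSite j y → (∃ x ∈ iterBlock j y, chartY i x ∈ D) →
      ∀ μ, (ℓ + 1) ^ (j + 1) ≤ (y μ).val * (ℓ + 1) ^ j ∧ (y μ).val * (ℓ + 1) ^ j + (ℓ + 1) ^ j + (ℓ + 1) ^ (j + 1) ≤ (PV d ℓ i.m i.K hd hL).sitesPerDir 0)
    (hmargT : ∀ Y : Site (PV d ℓ i.m i.K hd hL) (j + 1), (domT i.hN i.D i.hk).LamSite (j + 1) Y →
      (∃ Y₀ : Site (PV d ℓ i.m i.K hd hL) (j + 1), (∃ x : Site (PV d ℓ i.m i.K hd hL) 0, iterBlockOf (j + 1) x = Y₀ ∧ chartY i x ∈ D) ∧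
        (Y = Y₀ ∨ ∃ μ, Y = Y₀.shift μ ∨ Y₀ = Y.shift μ)) →
      ∀ μ, (ℓ + 1) ^ (j + 1) ≤ (Y μ).val * (ℓ + 1) ^ (j + 1) ∧ (Y μ).val * (ℓ + 1) ^ (j + 1) + 2 * (ℓ + 1) ^ (j + 1) ≤ (PV d ℓ i.m i.K hd hL).sitesPerDir 0)
    {w₀ : ℝ} (hw₀ : 0 < w₀) (hw : ∀ ι : IBondY i, w₀ ≤ i.w ι) (v : FBondY i → ℝ)
    (hst : ∀ (j' : ℕ) (y : Site (PV d ℓ i.m i.K hd hL) j'), (domT i.hN i.D i.hk).LamSite j' y → (∀ x ∈ iterBlock j' y, chartY i x ∈ D) →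
      ∀ x ∈ iterBlock j' y, stairSum v (cornerV1 j' y) x = 0)
    (hoff : ∀ b : FBondY i, chartY i b.src ∉ D → chartY i b.tgt ∉ D → v b = 0) :
    (12 * (((d + 1 : ℕ) : ℝ)) ^ 2 * (1 + 12 * (((d + 1 : ℕ) : ℝ)) * ((((ℓ + 1 : ℕ) : ℝ)) ^ j) ^ 2))⁻¹ *
          (((((ℓ + 1 : ℕ) : ℝ)) ^ (j + 1)) ^ (d + 1 + 1))⁻¹ * min (i.cf ^ 2 / 2) (w₀ / ((((ℓ + 1 : ℕ) : ℝ)) ^ (j + 1)) ^ (d + 1 - 2)) *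
        ∑ b, v b ^ 2 ≤
      ∑ p, (curlK i *ᵥ v) p ^ 2 + ∑ ι, i.w ι * (qK i *ᵥ v) ι ^ 2 := by
  classical
  have hjm : j + 1 ≤ i.m + i.K := hjk.trans i.hk
  have hjm0 : j ≤ i.m + i.K := (Nat.le_succ j).trans hjm
  -- the two block sets
  set S : Finset (Site (PV d ℓ i.m i.K hd hL) j) :=
    Finset.univ.filter fun y => (domT i.hN i.D i.hk).LamSite j y ∧ ∃ x ∈ iterBlock j y, chartY i x ∈ D with hSdef
  set T : Finset (Site (PV d ℓ i.m i.K hd hL) (j + 1)) :=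
    Finset.univ.filter fun Y => (domT i.hN i.D i.hk).LamSite (j + 1) Y ∧
      ((∃ x ∈ iterBlock (j + 1) Y, chartY i x ∈ D) ∨
        ∃ bb : PBond (PV d ℓ i.m i.K hd hL) j, (blockOf bb.src = Y ∨ blockOf bb.tgt = Y) ∧
          ∃ y₀ : Site (PV d ℓ i.m i.K hd hL) 0, (iterBlockOf j y₀ = bb.src ∨ iterBlockOf j y₀ = bb.tgt) ∧ chartY i y₀ ∈ D ∧
            i.D.lev (toBox i.hN y₀ : Fin (d + 1) → ℤ) = j) with hTdef
  have hS : ∀ {y}, y ∈ S ↔ _ := fun {y} => by rw [hSdef, Finset.mem_filter, and_iff_right (Finset.mem_univ _)]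
  have hT : ∀ {Y}, Y ∈ T ↔ _ := fun {Y} => by rw [hTdef, Finset.mem_filter, and_iff_right (Finset.mem_univ _)]
  -- every block of `T` is EQUAL OR ADJACENT to a big block meeting `D`
  have hTadj : ∀ Y ∈ T, ∃ Y₀ : Site (PV d ℓ i.m i.K hd hL) (j + 1),
      (∃ x : Site (PV d ℓ i.m i.K hd hL) 0, iterBlockOf (j + 1) x = Y₀ ∧ chartY i x ∈ D) ∧ (Y = Y₀ ∨ ∃ μ, Y = Y₀.shift μ ∨ Y₀ = Y.shift μ) := by
    intro Y hY
    obtain ⟨-, hin | ⟨bb, hbY, y₀, hy₀, hD₀, -⟩⟩ := hT.1 hY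
    · obtain ⟨x, hx, hxD⟩ := hin
      exact ⟨Y, ⟨x, (mem_iterBlock _ _ _).1 hx, hxD⟩, Or.inl rfl⟩
    · -- the collar case: `Y` is the big block of an end `z` of `bb`, `y₀` lies under an end `e` of `bb`
      obtain ⟨z, hz, hzY⟩ : ∃ z : Site (PV d ℓ i.m i.K hd hL) j, (z = bb.src ∨ z = bb.tgt) ∧ blockOf z = Y := by
        rcases hbY with h | h; exacts [⟨bb.src, Or.inl rfl, h⟩, ⟨bb.tgt, Or.inr rfl, h⟩]
      obtain ⟨e, he, hy₀e⟩ : ∃ e : Site (PV d ℓ i.m i.K hd hL) j, (e = bb.src ∨ e = bb.tgt) ∧ iterBlockOf j y₀ = e := by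
        rcases hy₀ with h | h; exacts [⟨bb.src, Or.inl rfl, h⟩, ⟨bb.tgt, Or.inr rfl, h⟩]
      refine ⟨blockOf e, ⟨y₀, iterBlockOf_succ_eq_blockOf i hy₀e, hD₀⟩, ?_⟩
      rw [← hzY]
      exact adj_blockOf_ends i hjm bb he hz
  -- (hST): a `Λ_j`-site is not under a `Λ_{j+1}`-site (the partition (2.4))
  have hST : ∀ y ∈ S, blockOf y ∉ T := by
    intro y hy hyT
    have hlam := (hS.1 hy).1
    have hlam' := (hT.1 hyT).1
    obtain ⟨x, hx⟩ := exists_iterBlockOf_eq (hd := hd) (hL := hL) hjm0 y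
    rw [← hx] at hlam
    rw [← iterBlockOf_succ_eq_blockOf i hx] at hlam'
    exact absurd ((domT i.hN i.D i.hk).lamSite_iterBlockOf_unique hlam hlam') (by omega)
  -- (hIS): the index facts at scale `j`
  have hIS : ∀ bb : PBond (PV d ℓ i.m i.K hd hL) j, (bb.src ∈ S ∨ bb.tgt ∈ S) → blockOf bb.src ∉ T → blockOf bb.tgt ∉ T →
      (domT i.hN i.D i.hk).LamBond j bb := by
    intro bb hS' hsT htT
    -- the end `e ∈ S` and the other end `z`
    have key : ∀ e z : Site (PV d ℓ i.m i.K hd hL) j, (e = bb.src ∨ e = bb.tgt) → (z = bb.src ∨ z = bb.tgt) → e ∈ S →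
        ¬ (domT i.hN i.D i.hk).Deep j z := by
      intro e z he hz heS hdeep
      have hzT : blockOf z ∉ T := by rcases hz with rfl | rfl <;> assumption
      obtain ⟨hlamz, hlevz⟩ := lamSite_blockOf_of_deep i hjk D hNbr2 bb he hz (hS.1 heS) hdeep
      refine hzT (hT.2 ⟨hlamz, Or.inr ⟨bb, ?_, ?_⟩⟩)
      · rcases hz with rfl | rfl; exacts [Or.inl rfl, Or.inr rfl]
      · obtain ⟨hlame, x₀, hx₀, hD₀⟩ := hS.1 heS
        have hx₀e : iterBlockOf j x₀ = e := (mem_iterBlock j e x₀).1 hx₀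
        refine ⟨x₀, ?_, hD₀, ?_⟩
        · rcases he with rfl | rfl; exacts [Or.inl hx₀e, Or.inr hx₀e]
        · rw [← hx₀e] at hlame
          exact (lamSite_domT_iff i.hN i.D i.hk j x₀).1 hlame
    rcases hS' with h | h
    · have hlam := (hS.1 h).1
      exact ⟨Or.inl hlam.1, hlam.2, key bb.src bb.tgt (Or.inl rfl) (Or.inr rfl) h⟩
    · have hlam := (hS.1 h).1
      exact ⟨Or.inr hlam.1, key bb.tgt bb.src (Or.inr rfl) (Or.inl rfl) h, hlam.2⟩
  -- (hIB): the index facts at scale `j+1`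
  have hIB : ∀ BB : PBond (PV d ℓ i.m i.K hd hL) (j + 1), (BB.src ∈ T ∨ BB.tgt ∈ T) → (domT i.hN i.D i.hk).LamBond (j + 1) BB := by
    intro BB hBT
    have key : ∀ Y Z : Site (PV d ℓ i.m i.K hd hL) (j + 1), (Y = BB.src ∨ Y = BB.tgt) → (Z = BB.src ∨ Z = BB.tgt) → Y ∈ T →
        ¬ (domT i.hN i.D i.hk).Deep (j + 1) Z := by
      intro Y Z hY hZ hYT hdeep
      by_cases hk2 : i.k ≤ j + 1
      · exact (domT i.hN i.D i.hk).not_deep_of_le (show (domT i.hN i.D i.hk).k ≤ j + 1 from hk2) Z hdeep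
      · have hk2' : j + 1 + 1 ≤ i.k := by omega
        have hjm2 : j + 1 ≤ i.m + i.K := hjm
        obtain ⟨y, hy⟩ := exists_iterBlockOf_eq (hd := hd) (hL := hL) hjm2 Z
        have hge : j + 1 + 1 ≤ i.D.lev (toBox i.hN y : Fin (d + 1) → ℤ) := by
          refine (iterBlockOf_mem_domT_iff i.hN i.D i.hk (by omega) hk2' y).1 ?_
          rw [iterBlockOf_succ_eq_blockOf i hy]; exact hdeep
        obtain ⟨Y₀, hY₀, hadj⟩ := hTadj Y hYT
        have hadj' : Z = Y ∨ ∃ μ, Z = Y.shift μ ∨ Y = Z.shift μ := by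
          rcases hY with rfl | rfl <;> rcases hZ with rfl | rfl
          · exact Or.inl rfl
          · exact Or.inr ⟨BB.dir, Or.inl rfl⟩
          · exact Or.inr ⟨BB.dir, Or.inr rfl⟩
          · exact Or.inl rfl
        have hle := hNbr2 Y₀ Y Z hY₀ hadj hadj' y hy
        omega
    rcases hBT with h | h
    · have hlam := (hT.1 h).1
      exact ⟨Or.inl hlam.1, hlam.2, key BB.src BB.tgt (Or.inl rfl) (Or.inr rfl) h⟩
    · have hlam := (hT.1 h).1
      exact ⟨Or.inr hlam.1, key BB.tgt BB.src (Or.inr rfl) (Or.inl rfl) h, hlam.2⟩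
  -- the label margins
  have hboxS : ∀ y ∈ S, ∀ μ, (ℓ + 1) ^ (j + 1) ≤ (y μ).val * (ℓ + 1) ^ j ∧
      (y μ).val * (ℓ + 1) ^ j + (ℓ + 1) ^ j + (ℓ + 1) ^ (j + 1) ≤ (PV d ℓ i.m i.K hd hL).sitesPerDir 0 := fun y hy =>
    hmargS y (hS.1 hy).1 (hS.1 hy).2
  have hboxT : ∀ Y ∈ T, ∀ μ, (ℓ + 1) ^ (j + 1) ≤ (Y μ).val * (ℓ + 1) ^ (j + 1) ∧
      (Y μ).val * (ℓ + 1) ^ (j + 1) + 2 * (ℓ + 1) ^ (j + 1) ≤ (PV d ℓ i.m i.K hd hL).sitesPerDir 0 := fun Y hY =>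
    hmargT Y (hT.1 hY).1 (hTadj Y hY)
  -- `v` is carried by the bonds meeting the blocks of `S` and `T`
  have hoff' : ∀ b : FBondY i, v b ≠ 0 →
      (∃ y ∈ S, b.src ∈ iterBlock j y ∨ b.tgt ∈ iterBlock j y) ∨ (∃ Y ∈ T, b.src ∈ iterBlock (j + 1) Y ∨ b.tgt ∈ iterBlock (j + 1) Y) := by
    intro b hb
    -- an end point `e` of `b` lies in `D`
    obtain ⟨e, he, heD⟩ : ∃ e : Site (PV d ℓ i.m i.K hd hL) 0, (e = b.src ∨ e = b.tgt) ∧ chartY i e ∈ D := by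
      by_contra h
      push Not at h
      exact hb (hoff b (h b.src (Or.inl rfl)) (h b.tgt (Or.inr rfl)))
    have hmem : ∀ (j' : ℕ) (Y : Site (PV d ℓ i.m i.K hd hL) j'), iterBlockOf j' e = Y → b.src ∈ iterBlock j' Y ∨ b.tgt ∈ iterBlock j' Y := by
      intro j' Y hY
      rcases he with rfl | rfl
      · exact Or.inl ((mem_iterBlock _ _ _).2 hY)
      · exact Or.inr ((mem_iterBlock _ _ _).2 hY)
    rcases h2 e heD with hl | hl
    · refine Or.inl ⟨iterBlockOf j e, hS.2 ⟨(lamSite_domT_iff i.hN i.D i.hk j e).2 hl, e, (mem_iterBlock _ _ _).2 rfl, heD⟩, hmem j _ rfl⟩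
    · refine Or.inr ⟨iterBlockOf (j + 1) e, hT.2 ⟨(lamSite_domT_iff i.hN i.D i.hk (j + 1) e).2 hl, Or.inl ⟨e, (mem_iterBlock _ _ _).2 rfl, heD⟩⟩,
        hmem (j + 1) _ rfl⟩
  -- staircase sums on the blocks of `S` (inside `D`: the class) and of `T` (inside `D`: the class; off `D`: `v` vanishes inside)
  have hTs : ∀ y ∈ S, ∀ x ∈ iterBlock j y, stairSum v (cornerV1 j y) x = 0 := fun y hy =>
    hst j y (hS.1 hy).1 (block_subset_of_witness i D hD (hS.1 hy).1 (hS.1 hy).2)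
  have hTb : ∀ Y ∈ T, ∀ x ∈ iterBlock (j + 1) Y, stairSum v (cornerV1 (j + 1) Y) x = 0 := by
    intro Y hY
    have hlam := (hT.1 hY).1
    by_cases hin : ∃ x ∈ iterBlock (j + 1) Y, chartY i x ∈ D
    · exact hst (j + 1) Y hlam (block_subset_of_witness i D hD hlam hin)
    · push Not at hin
      exact stairSum_cornerV1_eq_zero_of_vanish (P := PV d ℓ i.m i.K hd hL) hjm v Y fun b hs ht => hoff b (hin _ hs) (hin _ ht)
  exact local_lemma24_real_twoLevel i hd2 (show j + 1 ≤ (domT i.hN i.D i.hk).k from hjk) S T hST hboxS hboxT hIS hIB hw₀ hw v hoff' hTs hTb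

end DefY


end Literature.MathematicalPhysics.QuantumFieldTheory.Balaban1983to89.B9LocalLemma24TwoLevelCollarY

end
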